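import Mathlib
import Summits.Ventures.HodgeRepro2.T5CartanCellsDistinct
import Summits.Ventures.HodgeRepro2.T5HeckeDoubleCosetBasis

/-!
# `H(U(2,1), K_U)` has the basis `T_k = 𝟙_{K diag(ϖ^k,1,ϖ^{-k}) K}`, `k ∈ ℕ`

Blind cell `pub-hodge-repro2`, seat p8 (gen 13), Tier-5 kernel support.  `T5HeckeDoubleCosetBasis`
(T5-54) gives the basis of `H(G, K)` indexed by the finite double cosets `K g K`
(`heckeAlgebraBasis`, with `heckeAlgebraBasis_eq_doubleCosetOp`).  For the record's `U(2,1)` at an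
inert place the double cosets are the Cartan cells `K_U diag(ϖ^k, 1, ϖ^{-k}) K_U`, `k ∈ ℕ`:
the Cartan decomposition (`T5CartanUnitaryThree`, with the Weyl element `J₃ ∈ K_U` and
`w D w⁻¹ = D⁻¹` for the negative exponents) says every double coset is a cell, and
`T5CartanCellsDistinct` says distinct `k` give distinct cells.  Hence:

* `doubleCosetOp_eq_iff` — **`T_g = T_{g'}` iff `K g K = K g' K`** (from the basis);
* `cellClass` / `cellClass_injective` / `cellClass_surjective` / `cellClassEquiv` — **the double
  cosets `K_U \ U(2,1) / K_U` are in bijection with `ℕ` through the cells**;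
* `heckeBasisCells` / `heckeBasisCells_apply` — **`{T_k}_{k ∈ ℕ}` is a basis of `H(U(2,1), K_U)`**
  (`heckeAlgebraBasis` reindexed along `cellClassEquiv`) — the module structure behind the Satake
  isomorphism `H(U(2,1), K_U) ≅ ℂ[X^{±1}]^W` («the Satake isomorphism» stays prose; its
  vector-space half is this file);
* `doubleCosetOp_cell_injective` / `linearIndependent_doubleCosetOp_cell` — `T_k = T_l ⟺ k = l`
  and the `T_k` are linearly independent.

README §8(d): uses an L-value-free non-vanishing device: NO.
-/

namespace Summit.Ventures.HodgeRepro2.T5HeckeBasisCells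

open IsLocalization T5CartanCellsDistinct T5HeckeDoubleCosetBasis

section General

variable {G : Type*} [Group G] (k : Type*) [Field k] (K : Subgroup G)

/-- The finite double coset of `g` (the class of `gK` under `K`). -/
def classOf (g : G) [Finite (MulAction.orbit K (g : G ⧸ K))] : FiniteDoubleCoset K :=
  ⟨Quotient.mk'' (g : G ⧸ K), by
    rw [MulAction.orbitRel.Quotient.orbit_mk]
    exact Set.toFinite _⟩

/-- The basis vector of the class of `g` is `T_g`. -/
theorem heckeAlgebraBasis_classOf (g : G) [Finite (MulAction.orbit K (g : G ⧸ K))] :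
    heckeAlgebraBasis k K (classOf K g) = T5HeckeDoubleCoset.doubleCosetOp k K g :=
  heckeAlgebraBasis_eq_doubleCosetOp k K _ g rfl

/-- Two elements have the same class iff their double cosets coincide. -/
theorem classOf_eq_iff (g g' : G) [Finite (MulAction.orbit K (g : G ⧸ K))]
    [Finite (MulAction.orbit K (g' : G ⧸ K))] :
    classOf K g = classOf K g' ↔ MulAction.orbit K (g : G ⧸ K) = MulAction.orbit K (g' : G ⧸ K) := by
  constructor
  · intro h
    have h1 : (classOf K g).1 = (classOf K g').1 := congrArg Subtype.val h
    change Quotient.mk'' (g : G ⧸ K) = Quotient.mk'' (g' : G ⧸ K) at h1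
    rw [← MulAction.orbitRel.Quotient.mem_orbit, MulAction.orbitRel.Quotient.orbit_mk] at h1
    exact MulAction.orbit_eq_iff.mpr h1
  · intro h
    apply Subtype.ext
    change Quotient.mk'' (g : G ⧸ K) = Quotient.mk'' (g' : G ⧸ K)
    rw [← MulAction.orbitRel.Quotient.mem_orbit, MulAction.orbitRel.Quotient.orbit_mk]
    exact MulAction.orbit_eq_iff.mp h

/-- **`T_g = T_{g'}` iff the double cosets coincide** (`K g K / K = K g' K / K` as orbits). -/
theorem doubleCosetOp_eq_iff (g g' : G) [Finite (MulAction.orbit K (g : G ⧸ K))]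
    [Finite (MulAction.orbit K (g' : G ⧸ K))] :
    T5HeckeDoubleCoset.doubleCosetOp k K g = T5HeckeDoubleCoset.doubleCosetOp k K g' ↔
      MulAction.orbit K (g : G ⧸ K) = MulAction.orbit K (g' : G ⧸ K) := by
  rw [← heckeAlgebraBasis_classOf, ← heckeAlgebraBasis_classOf, ← classOf_eq_iff]
  exact (heckeAlgebraBasis k K).injective.eq_iff

/-- **Double-coset operators of pairwise distinct double cosets are linearly independent.** -/
theorem linearIndependent_doubleCosetOp {ι : Type*} (a : ι → G)
    [∀ i, Finite (MulAction.orbit K ((a i : G) : G ⧸ K))]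
    (hinj : Function.Injective fun i => MulAction.orbit K ((a i : G) : G ⧸ K)) :
    LinearIndependent k fun i => T5HeckeDoubleCoset.doubleCosetOp k K (a i) := by
  have : (fun i => T5HeckeDoubleCoset.doubleCosetOp k K (a i)) =
      (heckeAlgebraBasis k K) ∘ fun i => classOf K (a i) := by
    funext i
    rw [Function.comp_apply, heckeAlgebraBasis_classOf]
  rw [this]
  refine (heckeAlgebraBasis k K).linearIndependent.comp _ fun i j hij => hinj ?_
  exact (classOf_eq_iff K (a i) (a j)).mp hij

end General

section Cells

variable {R E : Type*} [CommRing R] [Field E] [StarRing E] [Algebra R E] [IsFractionRing R E]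

/-- The cell representative `diag(ϖ^k, 1, ϖ^{-k})` lies in `U(antidiag(1, u, 1))` when `ϖ` is
star-fixed. -/
theorem cell_mem_formUnitaryGroup {ϖ : R} (hϖ : Irreducible ϖ)
    (hs : star (algebraMap R E ϖ) = algebraMap R E ϖ) (u : E) (k : ℕ) :
    cell (E := E) hϖ k ∈ T5UnitaryGroupForm.formUnitaryGroup (T5HermitianThreeElements.J3 u) := by
  refine T5UnitaryGroupForm.diagonalUnit_zpow_mem_formUnitaryGroup _ Fin.revPerm (piUnit hϖ)
    hs ?_ _ ?_
  · intro i j hij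
    rw [T5HermitianThreeElements.J3_eq] at hij
    fin_cases i <;> fin_cases j <;> simp_all
  · intro i
    fin_cases i <;> simp

/-- The cell representative as an element of `U(antidiag(1, u, 1))`. -/
noncomputable def cellU {ϖ : R} (hϖ : Irreducible ϖ)
    (hs : star (algebraMap R E ϖ) = algebraMap R E ϖ) (u : E) (k : ℕ) :
    T5UnitaryGroupForm.formUnitaryGroup (T5HermitianThreeElements.J3 u) :=
  ⟨cell (E := E) hϖ k, cell_mem_formUnitaryGroup hϖ hs u k⟩

/-- **The orbits `K_U a_k K_U / K_U` and `K_U a_l K_U / K_U` coincide iff `k = l`.** -/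
theorem orbit_cell_eq_iff {ϖ : R} (hϖ : Irreducible ϖ)
    (hs : star (algebraMap R E ϖ) = algebraMap R E ϖ) (u : E) (k l : ℕ) :
    MulAction.orbit (T5UnitaryHeckeAdjoint.hyperspecialSubgroup R (T5HermitianThreeElements.J3 u))
        (cellU hϖ hs u k : _ ⧸ T5UnitaryHeckeAdjoint.hyperspecialSubgroup R
          (T5HermitianThreeElements.J3 u)) =
      MulAction.orbit (T5UnitaryHeckeAdjoint.hyperspecialSubgroup R (T5HermitianThreeElements.J3 u))
        (cellU hϖ hs u l : _ ⧸ T5UnitaryHeckeAdjoint.hyperspecialSubgroup R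
          (T5HermitianThreeElements.J3 u)) ↔ k = l := by
  constructor
  · intro h
    rw [MulAction.orbit_eq_iff, MulAction.mem_orbit_iff] at h
    obtain ⟨κ, hκ⟩ := h
    have hκ' : (QuotientGroup.mk ((κ : T5UnitaryGroupForm.formUnitaryGroup
        (T5HermitianThreeElements.J3 u)) * cellU hϖ hs u l) :
          _ ⧸ T5UnitaryHeckeAdjoint.hyperspecialSubgroup R (T5HermitianThreeElements.J3 u)) =
        QuotientGroup.mk (cellU hϖ hs u k) := by
      rw [← hκ]
      change _ = ((κ : T5UnitaryGroupForm.formUnitaryGroup (T5HermitianThreeElements.J3 u)) •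
        (QuotientGroup.mk (cellU hϖ hs u l) : _ ⧸ T5UnitaryHeckeAdjoint.hyperspecialSubgroup R
          (T5HermitianThreeElements.J3 u)))
      rw [MulAction.Quotient.smul_mk]
      rfl
    rw [QuotientGroup.eq] at hκ'
    -- `a_k = κ * a_l * ((κ * a_l)⁻¹ * a_k)` with both factors in `K_U`
    refine (eq_of_mem_doubleCoset hϖ (T5HermitianThreeElements.J3 u) (k := l) (l := k) κ.2 hκ' ?_).symm
    simp only [cellU, Subgroup.coe_mul, Subgroup.coe_inv]
    group
  · rintro rfl
    rfl

variable [IsDomain R] [IsDiscreteValuationRing R] [Finite (IsLocalRing.ResidueField R)]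

/-- The double coset (class) of the `k`-th cell. -/
noncomputable def cellClass {ϖ : R} (hϖ : Irreducible ϖ)
    (hs : star (algebraMap R E ϖ) = algebraMap R E ϖ) (u : E) (k : ℕ) :
    FiniteDoubleCoset (T5UnitaryHeckeAdjoint.hyperspecialSubgroup R (T5HermitianThreeElements.J3 u)) :=
  classOf _ (cellU hϖ hs u k)

/-- The cells give pairwise distinct double cosets. -/
theorem cellClass_injective {ϖ : R} (hϖ : Irreducible ϖ)
    (hs : star (algebraMap R E ϖ) = algebraMap R E ϖ) (u : E) :
    Function.Injective (cellClass (E := E) hϖ hs u) := by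
  intro i j hij
  rw [cellClass, cellClass, classOf_eq_iff, orbit_cell_eq_iff] at hij
  exact hij

omit [IsDomain R] [IsDiscreteValuationRing R] [Finite (IsLocalRing.ResidueField R)]
  [IsFractionRing R E] in
/-- The Weyl element `J₃ = permUnit rev` lies in `K_U`. -/
theorem permUnit_rev_mem_hyperspecial (u : E) :
    (⟨T5CartanDominant.permUnit E Fin.revPerm, T5HermitianThreeElements.permUnit_rev3_mem u⟩ :
      T5UnitaryGroupForm.formUnitaryGroup (T5HermitianThreeElements.J3 u)) ∈
      T5UnitaryHeckeAdjoint.hyperspecialSubgroup R (T5HermitianThreeElements.J3 u) :=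
  Subgroup.mem_subgroupOf.mpr T5HermitianThreeElements.permUnit_rev3_mem_range

omit [IsDomain R] [IsDiscreteValuationRing R] [Finite (IsLocalRing.ResidueField R)] [StarRing E]
  [Algebra R E] [IsFractionRing R E] in
/-- An exponent vector with `m (rev i) = -m i` on `Fin 3` is `![m 0, 0, -m 0]`. -/
theorem eq_of_antisymm (m : Fin 3 → ℤ) (hm : ∀ i, m (Fin.revPerm i) = -m i) :
    m = ![m 0, 0, -m 0] := by
  have h0 : m 2 = -m 0 := hm 0
  have h1 : m 1 = -m 1 := hm 1
  funext i
  fin_cases i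
  · rfl
  · show m 1 = 0
    omega
  · exact h0

omit [IsDomain R] [IsDiscreteValuationRing R] [Finite (IsLocalRing.ResidueField R)] [StarRing E] in
/-- `diag(ϖ^k, 1, ϖ^{-k})` for `k : ℕ` is the cell representative. -/
theorem diagonalUnit_eq_cell {ϖ : R} (hϖ : Irreducible ϖ) (k : ℕ) :
    (T5CartanUniformiser.diagonalUnit fun i => (piUnit (E := E) hϖ) ^ (![(k : ℤ), 0, -k] i)) =
      cell hϖ k :=
  rfl

/-- The class of `κ₁ g κ₂` is the class of `g` for `κ₁, κ₂ ∈ K`. -/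
theorem classOf_mul_mul {G : Type*} [Group G] (K : Subgroup G) (g : G) {κ₁ κ₂ : G} (hκ₁ : κ₁ ∈ K)
    (hκ₂ : κ₂ ∈ K) [Finite (MulAction.orbit K (g : G ⧸ K))]
    [Finite (MulAction.orbit K ((κ₁ * g * κ₂ : G) : G ⧸ K))] :
    classOf K (κ₁ * g * κ₂) = classOf K g := by
  rw [classOf_eq_iff, MulAction.orbit_eq_iff, MulAction.mem_orbit_iff]
  refine ⟨⟨κ₁, hκ₁⟩, ?_⟩
  rw [QuotientGroup.mk_mul_of_mem _ hκ₂]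
  change ((κ₁ : G) • (g : G ⧸ K)) = _
  rw [MulAction.Quotient.smul_mk]
  rfl

/-- **Every double coset of `U(2,1)` is a cell**: by the Cartan decomposition `g = k₁ D k₂`,
`D = diag(ϖ^m, 1, ϖ^{-m})`, and the Weyl element `w = J₃ ∈ K_U` with `w D w⁻¹ = D⁻¹` when `m < 0`. -/
theorem cellClass_surjective (hstar : ∀ x : E, IsInteger R x → IsInteger R (star x)) (u : E)
    (hsu : star u = u) (hu0 : u ≠ 0) (hu : IsInteger R u) (hu' : IsInteger R u⁻¹) {ϖ : R}
    (hϖ : Irreducible ϖ) (hs : star (algebraMap R E ϖ) = algebraMap R E ϖ) :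
    Function.Surjective (cellClass (E := E) hϖ hs u) := by
  intro ω
  -- a representative `g` of the class `ω`
  obtain ⟨x, hx⟩ := Quotient.exists_rep ω.1
  obtain ⟨g, rfl⟩ := QuotientGroup.mk_surjective x
  have hω : ω = classOf _ g := Subtype.ext hx.symm
  obtain ⟨k₁, hk₁, k₂, hk₂, m, hm, hg⟩ :=
    T5CartanUnitaryThree.isCartanDecomposition_three hstar u hsu hu0 hu hu' ϖ hϖ hs g
  have hg2 : (g : GL (Fin 3) E) = (k₁ : GL (Fin 3) E) *
      (T5CartanUniformiser.diagonalUnit fun i => (piUnit (E := E) hϖ) ^ m i) * (k₂ : GL (Fin 3) E) :=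
    hg
  have hmeq := eq_of_antisymm m hm
  set w : T5UnitaryGroupForm.formUnitaryGroup (T5HermitianThreeElements.J3 u) :=
    ⟨T5CartanDominant.permUnit E Fin.revPerm, T5HermitianThreeElements.permUnit_rev3_mem u⟩ with hw
  have hwK := permUnit_rev_mem_hyperspecial (R := R) u
  rw [hω]
  rcases le_or_gt 0 (m 0) with hm0 | hm0
  · -- `m 0 ≥ 0`: `D` is the cell of `(m 0).toNat`
    refine ⟨(m 0).toNat, ?_⟩
    have hD : (T5CartanUniformiser.diagonalUnit fun i => (piUnit (E := E) hϖ) ^ m i) =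
        cell hϖ (m 0).toNat := by
      rw [← diagonalUnit_eq_cell]
      congr 1
      funext i
      rw [hmeq]
      fin_cases i <;> simp [Int.toNat_of_nonneg hm0]
    have hg' : g = k₁ * cellU hϖ hs u (m 0).toNat * k₂ := by
      apply Subtype.ext
      rw [Subgroup.coe_mul, Subgroup.coe_mul]
      exact hg2.trans (by rw [hD]; rfl)
    rw [cellClass, hg']
    exact (classOf_mul_mul _ _ hk₁ hk₂).symm
  · -- `m 0 < 0`: conjugate by the Weyl element, `w D w⁻¹ = D⁻¹ = cell (-m 0).toNat`
    refine ⟨(-m 0).toNat, ?_⟩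
    have hD : (T5CartanUniformiser.diagonalUnit fun i => (piUnit (E := E) hϖ) ^ m i)⁻¹ =
        cell hϖ (-m 0).toNat := by
      rw [← diagonalUnit_eq_cell, T5UnitaryGroupForm.diagonalUnit_inv]
      congr 1
      funext i
      rw [hmeq]
      fin_cases i <;> simp [Int.toNat_of_nonneg (neg_nonneg.mpr hm0.le), zpow_neg]
    have hconj := T5UnitaryGroupForm.permUnit_mul_diagonalUnit_zpow_mul_inv Fin.revPerm
      (piUnit (E := E) hϖ) m hm
    have hDw : (T5CartanUniformiser.diagonalUnit fun i => (piUnit (E := E) hϖ) ^ m i) =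
        (w : GL (Fin 3) E)⁻¹ * cell hϖ (-m 0).toNat * (w : GL (Fin 3) E) := by
      rw [← hD, ← hconj]
      simp only [hw]
      group
    have hg' : g = (k₁ * w⁻¹) * cellU hϖ hs u (-m 0).toNat * (w * k₂) := by
      apply Subtype.ext
      simp only [Subgroup.coe_mul, Subgroup.coe_inv]
      rw [hg2, hDw]
      simp only [cellU]
      group
    rw [cellClass, hg']
    exact (classOf_mul_mul _ _ (Subgroup.mul_mem _ hk₁ (Subgroup.inv_mem _ hwK))
      (Subgroup.mul_mem _ hwK hk₂)).symm

/-- **The double cosets `K_U \ U(2,1) / K_U` are in bijection with `ℕ` through the cells.** -/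
noncomputable def cellClassEquiv (hstar : ∀ x : E, IsInteger R x → IsInteger R (star x)) (u : E)
    (hsu : star u = u) (hu0 : u ≠ 0) (hu : IsInteger R u) (hu' : IsInteger R u⁻¹) {ϖ : R}
    (hϖ : Irreducible ϖ) (hs : star (algebraMap R E ϖ) = algebraMap R E ϖ) :
    ℕ ≃ FiniteDoubleCoset
      (T5UnitaryHeckeAdjoint.hyperspecialSubgroup R (T5HermitianThreeElements.J3 u)) :=
  Equiv.ofBijective (cellClass (E := E) hϖ hs u)
    ⟨cellClass_injective hϖ hs u, cellClass_surjective hstar u hsu hu0 hu hu' hϖ hs⟩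

/-- **`H(U(2,1), K_U)` has the basis `{T_k}_{k ∈ ℕ}`** — the module structure behind the Satake
isomorphism, in kernel: `T5HeckeDoubleCosetBasis.heckeAlgebraBasis` reindexed along the cells. -/
noncomputable def heckeBasisCells (hstar : ∀ x : E, IsInteger R x → IsInteger R (star x)) (u : E)
    (hsu : star u = u) (hu0 : u ≠ 0) (hu : IsInteger R u) (hu' : IsInteger R u⁻¹) {ϖ : R}
    (hϖ : Irreducible ϖ) (hs : star (algebraMap R E ϖ) = algebraMap R E ϖ) (k : Type*)
    [Field k] :
    Module.Basis ℕ k (T5HeckePermutationModule.heckeAlgebra k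
      (T5UnitaryHeckeAdjoint.hyperspecialSubgroup R (T5HermitianThreeElements.J3 u))) :=
  (heckeAlgebraBasis k _).reindex (cellClassEquiv hstar u hsu hu0 hu hu' hϖ hs).symm

/-- The `k`-th basis vector is the cell operator `T_k`. -/
theorem heckeBasisCells_apply (hstar : ∀ x : E, IsInteger R x → IsInteger R (star x)) (u : E)
    (hsu : star u = u) (hu0 : u ≠ 0) (hu : IsInteger R u) (hu' : IsInteger R u⁻¹) {ϖ : R}
    (hϖ : Irreducible ϖ) (hs : star (algebraMap R E ϖ) = algebraMap R E ϖ) (k : Type*)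
    [Field k] (i : ℕ) :
    heckeBasisCells hstar u hsu hu0 hu hu' hϖ hs k i =
      T5HeckeDoubleCoset.doubleCosetOp k
        (T5UnitaryHeckeAdjoint.hyperspecialSubgroup R (T5HermitianThreeElements.J3 u))
        (cellU hϖ hs u i) := by
  rw [heckeBasisCells, Module.Basis.reindex_apply, Equiv.symm_symm]
  exact heckeAlgebraBasis_classOf k _ (cellU hϖ hs u i)

/-- **`T_k = T_l ⟺ k = l`** in `H(U(2,1), K_U)`. -/
theorem doubleCosetOp_cell_injective {ϖ : R} (hϖ : Irreducible ϖ)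
    (hs : star (algebraMap R E ϖ) = algebraMap R E ϖ) (u : E) (k : Type*) [Field k] (i j : ℕ) :
    T5HeckeDoubleCoset.doubleCosetOp k
        (T5UnitaryHeckeAdjoint.hyperspecialSubgroup R (T5HermitianThreeElements.J3 u))
        (cellU hϖ hs u i) =
      T5HeckeDoubleCoset.doubleCosetOp k
        (T5UnitaryHeckeAdjoint.hyperspecialSubgroup R (T5HermitianThreeElements.J3 u))
        (cellU hϖ hs u j) ↔ i = j := by
  rw [doubleCosetOp_eq_iff, orbit_cell_eq_iff]

/-- **The `T_k`, `k ∈ ℕ`, are linearly independent** in `H(U(2,1), K_U)`. -/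
theorem linearIndependent_doubleCosetOp_cell {ϖ : R} (hϖ : Irreducible ϖ)
    (hs : star (algebraMap R E ϖ) = algebraMap R E ϖ) (u : E) (k : Type*) [Field k] :
    LinearIndependent k fun i : ℕ => T5HeckeDoubleCoset.doubleCosetOp k
      (T5UnitaryHeckeAdjoint.hyperspecialSubgroup R (T5HermitianThreeElements.J3 u))
      (cellU hϖ hs u i) :=
  linearIndependent_doubleCosetOp k _ (fun i => cellU hϖ hs u i) fun i j hij =>
    (orbit_cell_eq_iff hϖ hs u i j).mp hij

end Cells

end Summit.Ventures.HodgeRepro2.T5HeckeBasisCells
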